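import Summits.QuantumFields.BalabanUV.T4Continuum.Support.DirichletCornerCutoutCover

/-!
# `BalabanUV.T4Continuum.Support.DirichletCornerCutoutFar` — NE2 (node U1a) formalisation swarm, sub-row `T4-U1a.S-NE2-D1-DIRICHLET°`, supplier item
# «Δ1-SKELETON» (file 10b): THE CUT-OUT COVERS THE CORNERS — `etaC = 1` on the `2`-step neighbourhood of every `NearCorner β` set of every
# `−μ`-exposed block (`R′ ≥ 2R + 2`), hence the field `(1 − etaC)·v` satisfies the support hypothesis `hfar` of file 7's `psiS_relSmoothIn`
# for EVERY `v` (unit b2b-balaban-t4-ne2-formalise-leaf-08, gen 7, file 10b; split off file 10 for the 400-line rule)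

HONEST FRAMING.  Rung (B)+1 bookkeeping at MODEL level, finite torus; pure lattice combinatorics; NE2 (U1a) is NOT proved by this file;
spine PROVED 0/9 unchanged; NOT infinite volume, NOT the mass gap, NOT Clay.  HONEST DEPENDENCY (verbatim): «continuum YM on T⁴ ⇐ BetaPertH ∧
nine spine estimates (0/9 proved); BetaPertH ⇐ (D1) ∧ (D4) ∧ CAP+tail; G-an2-4 gates asym, D1 and NE2/3/4.»

WHAT THIS FILE PROVES (0 sorry).  `etaC_eq_one_around`, `cut_eq_zero_of_etaC`, **`hfar_of_etaC`**: for `z′ = cut (1 − etaC) v`,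
`z′ y ≠ 0 ∨ z′(y ± e_ν) ≠ 0` forces `y, y ± e_ν ∉ NearCorner β` for every exposed `β` (`2R + 2 ≤ R′`, `2(R′+R) ≤ n`) — exactly the hypothesis
of `psiS_relSmoothIn`; corollary **`psiS_relSmoothIn_cutout`**.

ABSOLUTE RULE (cell, verbatim): «No internally-minted statement may enter as a cited fact. Every hypothesis is either kernel-proved in
this package or a verbatim quotation of a PUBLISHED theorem with page reference. The manuscript(s) under audit are NOT citable for
their own disputed steps — they are the thing under adjudication; programme-internal (2001/route/tribunal) claims are never citable.»
[folklore] lattice bookkeeping; no definition; no `def … : Prop` fact.  NOT CLAIMED: the two-level law; NE2; NE3.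
-/

noncomputable section

open scoped BigOperators
open Finset

namespace Summit.QuantumFields.BalabanUV.T4Continuum.DirichletCornerCutoutFar

open Literature.MathematicalPhysics.QuantumFieldTheory.Balaban1983to89.B5Prop11Plancherel (Tor fine unitVec)
open Literature.MathematicalPhysics.QuantumFieldTheory.Balaban1983to89.B5Blocks16 (blockOf)
open Summit.QuantumFields.BalabanUV.Beta.GAN24.DirichletBoxTrace (blockReg)
open Summit.QuantumFields.BalabanUV.T4Continuum.DirichletMonotoneCutoff (offsF blockOf_offsF_add_of_lt blockOf_offsF_add_of_eq blockOf_offsF_sub)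
open Summit.QuantumFields.BalabanUV.T4Continuum.ScaleProfile (qprof qprof_eq_one qprof_eq_zero)
open Summit.QuantumFields.BalabanUV.T4Continuum.DirichletDirectionalBesovCutoff (cut)
open Summit.QuantumFields.BalabanUV.T4Continuum.DirichletDipCutoff (BotExp psiS)
open Summit.QuantumFields.BalabanUV.T4Continuum.DirichletDipCutoffAxis (liftA add_unitVec_self add_unitVec_ne sub_unitVec_self sub_unitVec_ne
  one_ne_zero_of_botExp)
open Summit.QuantumFields.BalabanUV.T4Continuum.DirichletDipCutoffCorner (NearPlane NearFace NearCorner)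
open Summit.QuantumFields.BalabanUV.T4Continuum.DirichletDipCutoffSmooth (psiS_relSmoothIn ell1 ell2)
open Summit.QuantumFields.BalabanUV.T4Continuum.DirichletCornerCutout (Hp Dp Ep)
open Summit.QuantumFields.BalabanUV.T4Continuum.DirichletCornerCutoutEta (cfac Cb CornerIdx etaC Cb_eq_one_of etaC_eq_one_of_Cb)
open Summit.QuantumFields.BalabanUV.T4Continuum.DirichletRelativeBesovIntrinsic (RelSmoothIn)
open Summit.QuantumFields.BalabanUV.T4Continuum.DirichletCornerCutoutCover

variable {d : ℕ} (n : ℕ) [NeZero n] (M : Fin d → ℕ) [hM : ∀ μ, NeZero (M μ)] (μ : Fin d)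

/-! ## §3 The support hypothesis of `psiS_relSmoothIn` for the cut-out field -/

section Far

variable {n M μ} {S : Tor M → Prop} [DecidablePred S] {R R' : ℕ} (hR : 2 ≤ R) (hRR : 2 * R + 2 ≤ R') (hn : 2 * (R' + R) ≤ n)
include hR hRR hn

/-- `etaC = 1` at `x`, `x ± e_ν`, `x ± 2e_ν` whenever `x` is `NearCorner β` for an exposed `β`. [folklore] -/
theorem etaC_eq_one_around {β : Tor M} (hBE : BotExp M S μ β) {x : Tor (fine n M)} (h : NearCorner n M μ R β x) (ν : Fin d) :
    etaC n M S μ R R' x = 1 ∧ etaC n M S μ R R' (x + unitVec (fine n M) ν) = 1 ∧ etaC n M S μ R R' (x - unitVec (fine n M) ν) = 1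
      ∧ etaC n M S μ R R' (x + unitVec (fine n M) ν + unitVec (fine n M) ν) = 1
      ∧ etaC n M S μ R R' (x - unitVec (fine n M) ν - unitVec (fine n M) ν) = 1 := by
  obtain ⟨κ₁, κ₂, h1, h2, h12, hNC⟩ := NC_of_nearCorner h
  have hidx : CornerIdx M S μ β κ₁ κ₂ := ⟨hBE, h1, h2, h12⟩
  have hρ0 : 2 * R + 2 ≤ n := by omega
  have hρ1 : 2 * R + 1 + 2 ≤ n := by omega
  have hA := NC_add (μ := μ) hρ0 ν hNC
  have hS := NC_sub (μ := μ) hρ0 ν hNC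
  exact ⟨etaC_eq_one_of_NC hR hn (by omega) hidx hNC, etaC_eq_one_of_NC hR hn (by omega) hidx hA,
    etaC_eq_one_of_NC hR hn (by omega) hidx hS, etaC_eq_one_of_NC hR hn (by omega) hidx (NC_add (μ := μ) hρ1 ν hA),
    etaC_eq_one_of_NC hR hn (by omega) hidx (NC_sub (μ := μ) hρ1 ν hS)⟩

omit hR hRR hn in
/-- the cut-out field vanishes where `etaC = 1`. [folklore] -/
theorem cut_eq_zero_of_etaC {v : Tor (fine n M) → ℂ} {y : Tor (fine n M)} (h : etaC n M S μ R R' y = 1) :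
    cut (fine n M) (fun w => 1 - etaC n M S μ R R' w) v y = 0 := by
  simp [cut, h]

/-- **THE SUPPORT HYPOTHESIS `hfar`** of file 7's `psiS_relSmoothIn`, for the cut-out field `z′ = (1 − etaC)·v` and ANY `v`. [folklore] -/
theorem hfar_of_etaC (v : Tor (fine n M) → ℂ) (x : Tor (fine n M)) (ν : Fin d)
    (hz : cut (fine n M) (fun w => 1 - etaC n M S μ R R' w) v x ≠ 0
      ∨ cut (fine n M) (fun w => 1 - etaC n M S μ R R' w) v (x + unitVec (fine n M) ν) ≠ 0
      ∨ cut (fine n M) (fun w => 1 - etaC n M S μ R R' w) v (x - unitVec (fine n M) ν) ≠ 0)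
    (β : Tor M) (hBE : BotExp M S μ β) :
    ¬ NearCorner n M μ R β x ∧ ¬ NearCorner n M μ R β (x + unitVec (fine n M) ν) ∧ ¬ NearCorner n M μ R β (x - unitVec (fine n M) ν) := by
  refine ⟨fun hc => ?_, fun hc => ?_, fun hc => ?_⟩
  · obtain ⟨e0, e1, e2, -, -⟩ := etaC_eq_one_around hR hRR hn hBE hc ν
    rcases hz with h | h | h
    · exact h (cut_eq_zero_of_etaC e0)
    · exact h (cut_eq_zero_of_etaC e1)
    · exact h (cut_eq_zero_of_etaC e2)
  · obtain ⟨e0, -, e2, -, e4⟩ := etaC_eq_one_around hR hRR hn hBE hc ν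
    rw [add_sub_cancel_right] at e2 e4
    rcases hz with h | h | h
    · exact h (cut_eq_zero_of_etaC e2)
    · exact h (cut_eq_zero_of_etaC e0)
    · exact h (cut_eq_zero_of_etaC e4)
  · obtain ⟨e0, e1, -, e3, -⟩ := etaC_eq_one_around hR hRR hn hBE hc ν
    rw [sub_add_cancel] at e1 e3
    rcases hz with h | h | h
    · exact h (cut_eq_zero_of_etaC e1)
    · exact h (cut_eq_zero_of_etaC e3)
    · exact h (cut_eq_zero_of_etaC e0)

/-- **COROLLARY: `ψ_μ` is intrinsically smooth with respect to the cut-out field `(1 − etaC)·v`**, for every `v`, every `S`, every `d`, every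
torus (`2 ≤ R`, `4R ≤ n`, `2R + 2 ≤ R′`, `2(R′ + R) ≤ n`). [folklore] -/
theorem psiS_relSmoothIn_cutout (hn4 : 4 * R ≤ n) (v : Tor (fine n M) → ℂ) :
    RelSmoothIn (fine n M) (blockReg n M S) (cut (fine n M) (fun w => 1 - etaC n M S μ R R' w) v) (psiS n M S μ R) (ell1 d R) (ell2 d R) :=
  psiS_relSmoothIn hR hn4 fun x ν hz β hBE => hfar_of_etaC hR hRR hn v x ν hz β hBE

end Far

end Summit.QuantumFields.BalabanUV.T4Continuum.DirichletCornerCutoutFar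

end
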